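import Mathlib
import HarnessLib
import Summits.NavierStokesRegularity.NavierStokesRegularity.Theorems.TypeILiouvilleSteadySieve
import Summits.NavierStokesRegularity.NavierStokesRegularity.Theorems.TypeILiouvilleRecurrentSliceSieve

/-!
# TypeILiouvilleTransientCut — crux (L) stmt-NavierStokesRegularity-10661 `TypeIliouvilleL`:
# THE TRANSIENT CUT — (L) ⟺ EL ∧ (L)|totally-transient, and L_Q ⟺ L_Q|totally-transient (exact)

Helper for stmt-NavierStokesRegularity-10661 (`--supports`); theorems only, no definitions, no named-fact hypotheses;
closes no item; Navier–Stokes regularity is NOT proved here (leafhand seat of the EulerZoomLiouville route).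
Class P = print's class of bounded ancient mild solutions (continuous and bounded on `(−∞,0) × ℝ³`, weakly divergence
free, Oseen-mild).  A class-P flow is TOTALLY TRANSIENT if NO slice `v(t)` (`t < 0`) is the pointwise limit of earlier
slices `v(s_k)` along ANY sequence `s_k → −∞` (spelled inline; no `def`).

* `const_of_eternalLiouville_of_recurrentSlice'` — under EL (stmt-18161 BY NAME) a class-P flow with one pointwise
  α-recurrent slice is constant (KNSS Lemma 6.1 engine on the recurrence translates + `eternal_package` + one constant
  slice propagates, `classP_const_of_locallyConst_slice`; self-contained twin of `TypeILiouvilleRecurrentEternalBridge` §5).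
* `liouvilleL_iff_eternal_and_transient` — **(L) ⟺ EL ∧ (L)|totally-transient** (exact: ⟹ by the landed
  `eternalLiouville_of_liouvilleL` and the gauge theorem `oseenMild_const_of_liouvilleL'`; ⟸ by excluded middle on
  «some slice recurs», the recurrent case being EL's, and the gauge theorem `liouvilleL_of_oseenMild_const'`).
* `quiescentLiouville_iff_onTransient` — **L_Q ⟺ L_Q|totally-transient** (a quiescent flow with a recurrent slice is
  constant outright, `TypeILiouvilleRecurrentSliceSieve.const_of_quiescent_alphaRecurrentSlice`).

READING: next to the landed exact cuts `(L) ⟺ EL ∧ L_Q` (g16/g20) and `(L) ⟺ EL ∧ BCL|non-rec ∧ LSL|non-rec` (g24), the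
dynamical dial «does some slice recur, even pointwise along a subsequence?» gives `(L) ⟺ EL ∧ (L)|TT`: outside the
eternal door only TOTALLY TRANSIENT bounded ancient flows matter — flows whose backward orbit never returns, in the
topology of pointwise convergence, to any of its own slices (steady, periodic, almost-periodic, recurrent-near-the-origin
flows are all on EL's side).
[cite: KochNadirashviliSereginSverak2009, §1 p. 3, Lemma 6.1, Remark 6.1 (arXiv:0709.3599); LemarieRieusset2016, Thm. 9.12]
-/

noncomputable section

open MeasureTheory Filter Set Function Metric
open scoped Topology
open Literature.Analysis Literature.Analysis.FluidPDE Literature.Analysis.UnboundedOperators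
open Summit.NavierStokesRegularity.NavierStokesRegularity
open Summit.NavierStokesRegularity.NavierStokesRegularity.Theorems.TypeILiouvilleShoreline
open Summit.NavierStokesRegularity.NavierStokesRegularity.Theorems.TypeILiouvilleRecurrentSliceSieve

set_option linter.dupNamespace false

namespace Summit.NavierStokesRegularity.NavierStokesRegularity.Theorems.TypeILiouvilleTransientCut

/-- **EL ⟹ a class-P flow with ONE pointwise α-recurrent slice is constant.**  KNSS Lemma 6.1 compactness on the
recurrence translates `v(· + s_{ψ k})`, `s_{ψ k} < −(k+2)` (`printClass_translate_window`, `exists_oseenMild_eternal_limit`)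
yields an eternal bounded Oseen-mild flow `W` with `W(0) = v(t₀)`; EL (stmt-18161 BY NAME, via `eternal_package`) makes
`v(t₀)` constant, and one constant slice propagates (`classP_const_of_locallyConst_slice`).  (Same argument as §4–§5 of
`TypeILiouvilleRecurrentEternalBridge`, kept self-contained here.) [cite: KochNadirashviliSereginSverak2009, Lemma 6.1, Remark 6.1 (arXiv:0709.3599)] -/
theorem const_of_eternalLiouville_of_recurrentSlice' (hE : Theses.TypeTwoEternal.EternalLiouville)
    {v : ℝ → EuclideanSpace ℝ (Fin 3) → EuclideanSpace ℝ (Fin 3)}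
    (hc : ContinuousOn (uncurry v) (Iio 0 ×ˢ univ))
    (hK : ∃ K : ℝ, ∀ t < 0, ∀ x, ‖v t x‖ ≤ K)
    (hd : ∀ t < 0, IsWeaklyDivFree (v t))
    (hm : ∀ s t : ℝ, s < t → t < 0 → ∀ x,
      v t x = heatExtension (v s) (t - s) x - oseenDuhamel 1 s v v t x)
    {t₀ : ℝ} (ht₀ : t₀ < 0) {s : ℕ → ℝ} (hs : Tendsto s atTop atBot)
    (hlim : ∀ x, Tendsto (fun k => v (s k) x) atTop (𝓝 (v t₀ x))) :
    ∃ b : EuclideanSpace ℝ (Fin 3), ∀ t < 0, ∀ x, v t x = b := by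
  obtain ⟨K, hK'⟩ := hK
  -- a subsequence with `s (ψ k) < -(k+2)` and the translates on the windows `(−(k+1), −s_{ψ k})`
  have hev : ∀ k : ℕ, ∀ᶠ n in atTop, s n < -((k : ℝ) + 2) := fun k => hs.eventually (eventually_lt_atBot _)
  obtain ⟨ψ, hψ, hψs⟩ := extraction_forall_of_eventually hev
  have H := fun k => TypeILiouvilleShadowExtraction.printClass_translate_window hc hK' hd hm (s (ψ k)) 0
  have hAlim : Tendsto (fun k : ℕ => -((k : ℝ) + 1)) atTop atBot :=
    tendsto_neg_atTop_atBot.comp (tendsto_atTop_add_const_right atTop 1 tendsto_natCast_atTop_atTop)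
  have hBlim : Tendsto (fun k : ℕ => -s (ψ k)) atTop atTop :=
    tendsto_atTop_mono (fun k => by linarith [hψs k]) tendsto_natCast_atTop_atTop
  obtain ⟨φ, W, hφ, hWc, hWd, hWb, hWm, -, hpt, -⟩ :=
    TypeILiouvilleShadowExtraction.exists_oseenMild_eternal_limit
      (A := fun k : ℕ => -((k : ℝ) + 1)) (B := fun k => -s (ψ k))
      (w := fun k t x => v (t + s (ψ k)) (x + 0)) (C := K) hAlim hBlim
      (fun k => (H k).1.mono (prod_mono Ioo_subset_Iio_self Subset.rfl))
      (fun k t ht => (H k).2.2.1 t ht.2)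
      (fun k s t _ hst htB x => (H k).2.2.2 s t hst htB x)
      (fun k τ hτ x => (H k).2.1 τ hτ.2 x)
  -- `W(0) = v(t₀)`
  have hW0 : ∀ x, W 0 x = v t₀ x := fun x => by
    have h1 : Tendsto (fun j => v (s (ψ (φ j))) x) atTop (𝓝 (W 0 x)) := by
      have h := hpt 0 x
      simp only [zero_add, add_zero] at h
      exact h
    exact tendsto_nhds_unique h1 (((hlim x).comp hψ.tendsto_atTop).comp hφ.tendsto_atTop)
  -- EL on the eternal flow, then one constant slice propagates
  obtain ⟨h1, h2, h3, h4⟩ :=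
    TypeILiouvilleShadowExtraction.eternal_package (W := W) (C := K) hWc hWd hWb hWm
  obtain ⟨b, hb⟩ := hE W h1 h2 h3 h4 0
  have hslice : ∀ x ∈ (univ : Set (EuclideanSpace ℝ (Fin 3))), v t₀ x = b := fun x _ => by
    rw [← hW0 x]; exact hb x
  exact ⟨b, classP_const_of_locallyConst_slice hc ⟨K, hK'⟩ hm ht₀ isOpen_univ univ_nonempty hslice⟩

/-- **THE TRANSIENT CUT: (L) ⟺ EL ∧ (L)|totally-transient** (exact; TT spelled inline: no slice of `v` is the
pointwise limit of `v(s_k)` along any `s_k → −∞`). [cite: KochNadirashviliSereginSverak2009, §1 p. 3, Lemma 6.1 (arXiv:0709.3599)] -/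
theorem liouvilleL_iff_eternal_and_transient :
    Theses.TypeILiouville.TypeIliouvilleL ↔
    (Theses.TypeTwoEternal.EternalLiouville ∧
      ∀ v : ℝ → EuclideanSpace ℝ (Fin 3) → EuclideanSpace ℝ (Fin 3),
        ContinuousOn (uncurry v) (Iio 0 ×ˢ univ) →
        (∃ K : ℝ, ∀ t < 0, ∀ x, ‖v t x‖ ≤ K) →
        (∀ t < 0, IsWeaklyDivFree (v t)) →
        (∀ s t : ℝ, s < t → t < 0 → ∀ x,
          v t x = heatExtension (v s) (t - s) x - oseenDuhamel 1 s v v t x) →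
        (∀ t < 0, ∀ s : ℕ → ℝ, Tendsto s atTop atBot →
          ¬ (∀ x, Tendsto (fun k => v (s k) x) atTop (𝓝 (v t x)))) →
        ∃ b : EuclideanSpace ℝ (Fin 3), ∀ t < 0, ∀ x, v t x = b) := by
  constructor
  · intro hL
    exact ⟨TypeILiouvilleQuiescentShadow.eternalLiouville_of_liouvilleL hL,
      fun v hc hK hd hm _ => TypeILiouvilleQuiescentShadow.oseenMild_const_of_liouvilleL' hL v hc hK hd hm⟩
  · rintro ⟨hE, hTT⟩
    refine TypeILiouvilleQuiescentShadow.liouvilleL_of_oseenMild_const' fun v hc hK hd hm => ?_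
    by_cases hrec : ∃ t₀ : ℝ, t₀ < 0 ∧ ∃ s : ℕ → ℝ, Tendsto s atTop atBot ∧
        ∀ x, Tendsto (fun k => v (s k) x) atTop (𝓝 (v t₀ x))
    · obtain ⟨t₀, ht₀, s, hs, hlim⟩ := hrec
      exact const_of_eternalLiouville_of_recurrentSlice' hE hc hK hd hm ht₀ hs hlim
    · push Not at hrec
      exact hTT v hc hK hd hm fun t ht s hs hlim => by
        obtain ⟨x, hx⟩ := hrec t ht s hs
        exact hx (hlim x)

/-- **L_Q ⟺ L_Q|totally-transient** (exact): a quiescent class-P flow with one pointwise α-recurrent slice is constant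
outright (`const_of_quiescent_alphaRecurrentSlice`), so the registered residual `stub_quiescentLiouville` only ever speaks
about totally transient flows. [cite: KochNadirashviliSereginSverak2009, §1 p. 3 (arXiv:0709.3599)] -/
theorem quiescentLiouville_iff_onTransient :
    (∀ v : ℝ → EuclideanSpace ℝ (Fin 3) → EuclideanSpace ℝ (Fin 3),
      ContinuousOn (uncurry v) (Iio 0 ×ˢ univ) →
      (∃ K : ℝ, ∀ t < 0, ∀ x, ‖v t x‖ ≤ K) →
      (∀ t < 0, IsWeaklyDivFree (v t)) →
      (∀ s t : ℝ, s < t → t < 0 → ∀ x,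
        v t x = heatExtension (v s) (t - s) x - oseenDuhamel 1 s v v t x) →
      (∀ ε : ℝ, 0 < ε → ∃ T : ℝ, T < 0 ∧ ∀ t < T, ∀ x y : EuclideanSpace ℝ (Fin 3),
        dist x y ≤ 1 → ‖v t x - v t y‖ ≤ ε) →
      ∃ b : EuclideanSpace ℝ (Fin 3), ∀ t < 0, ∀ x, v t x = b) ↔
    (∀ v : ℝ → EuclideanSpace ℝ (Fin 3) → EuclideanSpace ℝ (Fin 3),
      ContinuousOn (uncurry v) (Iio 0 ×ˢ univ) →
      (∃ K : ℝ, ∀ t < 0, ∀ x, ‖v t x‖ ≤ K) →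
      (∀ t < 0, IsWeaklyDivFree (v t)) →
      (∀ s t : ℝ, s < t → t < 0 → ∀ x,
        v t x = heatExtension (v s) (t - s) x - oseenDuhamel 1 s v v t x) →
      (∀ ε : ℝ, 0 < ε → ∃ T : ℝ, T < 0 ∧ ∀ t < T, ∀ x y : EuclideanSpace ℝ (Fin 3),
        dist x y ≤ 1 → ‖v t x - v t y‖ ≤ ε) →
      (∀ t < 0, ∀ s : ℕ → ℝ, Tendsto s atTop atBot →
        ¬ (∀ x, Tendsto (fun k => v (s k) x) atTop (𝓝 (v t x)))) →
      ∃ b : EuclideanSpace ℝ (Fin 3), ∀ t < 0, ∀ x, v t x = b) := by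
  constructor
  · intro hQ v hc hK hd hm hq _
    exact hQ v hc hK hd hm hq
  · intro hQT v hc hK hd hm hq
    by_cases hrec : ∃ t₀ : ℝ, t₀ < 0 ∧ ∃ s : ℕ → ℝ, Tendsto s atTop atBot ∧
        ∀ x, Tendsto (fun k => v (s k) x) atTop (𝓝 (v t₀ x))
    · obtain ⟨t₀, ht₀, s, hs, hlim⟩ := hrec
      exact const_of_quiescent_alphaRecurrentSlice hc hK hm hq ht₀ hs hlim
    · push Not at hrec
      exact hQT v hc hK hd hm hq fun t ht s hs hlim => by
        obtain ⟨x, hx⟩ := hrec t ht s hs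
        exact hx (hlim x)

end Summit.NavierStokesRegularity.NavierStokesRegularity.Theorems.TypeILiouvilleTransientCut

end
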